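import Mathlib.Analysis.Complex.ReImTopology
import Mathlib.Topology.MetricSpace.Thickening
import Mathlib.Topology.UniformSpace.Compact
import Mathlib.Analysis.Normed.Affine.AddTorsor
import Mathlib.Topology.Algebra.Affine
import Mathlib.Topology.Order.IntermediateValue

/-!
# Stub `stub_CouplingToLimits` (line `pinned-diagram-exchange`, crux `CardyIKTransport.IKLinearTransport`,
# stmt-CriticalPhenomena-5076) — part 2: the deterministic crossing transfer through a chart

Support file (`--supports stmt-CriticalPhenomena-5076`). The geometric heart of the sandwich
`P_∅(Q⁻_ε) − ε ≤ P_univ(R) ≤ P_∅(Q⁺_ε) + ε`: an `ε`-SHADOW of a crude crossing is not a crude crossing of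
the same conformal rectangle (its points may leave the domain by `ε`, its ends are only `ε`-close to the
arcs), but it IS a crude crossing of a comparison rectangle. Read through a plane homeomorphism `Ψ`
(a square model of the rectangle, Schramm–Smirnov's `Q̂₀`): if `T = [a₀, a₁] × [b₀, b₁]` is taller and
narrower than `W = [x₀, x₁] × [y₀, y₁]` (`x₀ < a₀`, `a₁ < x₁`, `b₀ < y₀`, `y₁ < b₁`), then there is
`ε > 0` such that every chain of points with steps `≤ η ≤ ε`, all within `ε` of `Ψ(T)`, from within `ε`
of `Ψ(bottom of T)` to within `ε` of `Ψ(top of T)`, contains a consecutive sub-chain lying in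
`Ψ(interior of W)` whose first point is within `η` of `Ψ(bottom of W)` and whose last point is within
`η` of `Ψ(top of W)` (`exists_transfer_eps`). Proof: uniform continuity of `Ψ⁻¹` near `Ψ([-2,2]²)`
(`exists_chart_room`, as in the tree's `PlateChartRoom.exists_chart_room_symm'`), first passage above height `y₁` after the last passage below
height `y₀` in the model (list surgery `exists_split_first` / `exists_split_last`), and the
intermediate value theorem along the two junction segments.

References: O. Schramm, S. Smirnov, Ann. Probab. 39 (2011) §1.3 and proof of Lemma 5.1 (perturbed
quads `Q^q` through the extension `Q̂₀`); the line card `Cruxes/IKLinearTransport/Lines/pinned-diagram-exchange.md`.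
-/

noncomputable section

namespace Summit.CriticalPhenomena.CardyFormulaZ2.Theorems.IKLinearTransport.PinnedDiagramExchange

open Set Metric

namespace CouplingToLimits

/-! ## Chart room (uniform continuity of `Ψ⁻¹` near `Ψ([-2,2]²)`) -/

/-- CHART ROOM: for every `ν > 0` there is `ρ ∈ (0, 1]` such that a point within `ρ` of the image of a
point of `[-2, 2]²` pulls back to within `ν` of it (uniform continuity of `Ψ⁻¹` on the compact
`1`-thickening of `Ψ([-2, 2]²)`). [folklore] -/
-- adapted from Literature/Probability/Percolation/PlateChartRoom.lean (`exists_chart_room_symm'`)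
theorem exists_chart_room (Ψ : ℂ ≃ₜ ℂ) {ν : ℝ} (hν : 0 < ν) :
    ∃ ρ : ℝ, 0 < ρ ∧ ρ ≤ 1 ∧ ∀ z ∈ (Icc (-2 : ℝ) 2 ×ℂ Icc (-2 : ℝ) 2), ∀ p : ℂ,
      dist p (Ψ z) ≤ ρ → dist (Ψ.symm p) z ≤ ν := by
  set B : Set ℂ := Icc (-2 : ℝ) 2 ×ℂ Icc (-2 : ℝ) 2 with hB
  set K : Set ℂ := cthickening 1 (Ψ '' B) with hK
  have hBc : IsCompact B := isCompact_Icc.reProdIm isCompact_Icc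
  have hKc : IsCompact K := (hBc.image Ψ.continuous).cthickening
  have huc : UniformContinuousOn Ψ.symm K :=
    hKc.uniformContinuousOn_of_continuous Ψ.symm.continuous.continuousOn
  obtain ⟨ρ, hρ, h⟩ := Metric.uniformContinuousOn_iff_le.1 huc ν hν
  refine ⟨min ρ 1, lt_min hρ one_pos, min_le_right _ _, fun z hz p hp => ?_⟩
  have hΨz : Ψ z ∈ K := self_subset_cthickening _ (mem_image_of_mem Ψ hz)
  have hpK : p ∈ K :=
    mem_cthickening_of_dist_le p (Ψ z) 1 _ (mem_image_of_mem Ψ hz) (hp.trans (min_le_right _ _))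
  have := h p hpK (Ψ z) hΨz (hp.trans (min_le_left _ _))
  rwa [Homeomorph.symm_apply_apply] at this

/-- The real parts of two complex numbers differ by at most their distance. [folklore] -/
theorem abs_re_sub_le_dist (z w : ℂ) : |z.re - w.re| ≤ dist z w := by
  rw [dist_eq_norm, ← Complex.sub_re]; exact Complex.abs_re_le_norm _

/-- The imaginary parts of two complex numbers differ by at most their distance. [folklore] -/
theorem abs_im_sub_le_dist (z w : ℂ) : |z.im - w.im| ≤ dist z w := by
  rw [dist_eq_norm, ← Complex.sub_im]; exact Complex.abs_im_le_norm _

/-! ## List surgery -/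

section ListSplit

variable {α : Type*}

/-- Split a list at its FIRST element satisfying `P`. [folklore] -/
theorem exists_split_first (P : α → Prop) : ∀ (l : List α), (∃ a ∈ l, P a) →
    ∃ (m : List α) (b : α) (r : List α), l = m ++ b :: r ∧ (∀ a ∈ m, ¬ P a) ∧ P b
  | [], h => by simp at h
  | x :: xs, h => by
    classical
    by_cases hx : P x
    · exact ⟨[], x, xs, rfl, fun a ha => by simp at ha, hx⟩
    · have h' : ∃ a ∈ xs, P a := by
        obtain ⟨a, ha, hPa⟩ := h
        rcases List.mem_cons.1 ha with rfl | ha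
        · exact absurd hPa hx
        · exact ⟨a, ha, hPa⟩
      obtain ⟨m, b, r, hxs, hm, hb⟩ := exists_split_first P xs h'
      refine ⟨x :: m, b, r, by rw [hxs]; rfl, ?_, hb⟩
      intro a ha
      rcases List.mem_cons.1 ha with rfl | ha
      · exact hx
      · exact hm a ha

/-- Split a list at its LAST element satisfying `P`. [folklore] -/
theorem exists_split_last (P : α → Prop) (l : List α) (h : ∃ a ∈ l, P a) :
    ∃ (m : List α) (b : α) (r : List α), l = m ++ b :: r ∧ P b ∧ (∀ a ∈ r, ¬ P a) := by
  obtain ⟨m, b, r, hl, hm, hb⟩ := exists_split_first P l.reverse (by simpa using h)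
  refine ⟨r.reverse, b, m.reverse, ?_, hb, fun a ha => hm a (List.mem_reverse.1 ha)⟩
  have := congrArg List.reverse hl
  simpa using this

/-- Consecutive elements of a chain are related, wherever the cut. [folklore] -/
theorem rel_of_isChain_append_cons_cons {R : α → α → Prop} {l m₁ m₂ : List α} {a b : α}
    (h : List.IsChain R l) (hl : l = m₁ ++ a :: b :: m₂) : R a b :=
  List.isChain_iff_forall_rel_of_append_cons_cons.1 h hl

end ListSplit

/-! ## Intermediate values along a segment, read in the chart -/

/-- Along the segment from `p` to `q` the model height `im (Ψ⁻¹ ·)` takes every value between its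
values at the ends. [folklore] -/
theorem exists_lineMap_symm_im_eq (Ψ : ℂ ≃ₜ ℂ) {p q : ℂ} {y : ℝ} (hp : (Ψ.symm p).im ≤ y)
    (hq : y ≤ (Ψ.symm q).im) :
    ∃ t ∈ Icc (0 : ℝ) 1, (Ψ.symm (AffineMap.lineMap p q t)).im = y := by
  have hc : Continuous fun t : ℝ => (Ψ.symm (AffineMap.lineMap p q t)).im :=
    Complex.continuous_im.comp (Ψ.symm.continuous.comp AffineMap.lineMap_continuous)
  have h0 : (fun t : ℝ => (Ψ.symm (AffineMap.lineMap p q t)).im) 0 ≤ y := by simpa using hp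
  have h1 : y ≤ (fun t : ℝ => (Ψ.symm (AffineMap.lineMap p q t)).im) 1 := by simpa using hq
  obtain ⟨t, ht, hty⟩ := intermediate_value_Icc zero_le_one hc.continuousOn ⟨h0, h1⟩
  exact ⟨t, ht, hty⟩

/-- The same with the roles of the ends exchanged (decreasing height). [folklore] -/
theorem exists_lineMap_symm_im_eq' (Ψ : ℂ ≃ₜ ℂ) {p q : ℂ} {y : ℝ} (hp : y ≤ (Ψ.symm p).im)
    (hq : (Ψ.symm q).im ≤ y) :
    ∃ t ∈ Icc (0 : ℝ) 1, (Ψ.symm (AffineMap.lineMap p q t)).im = y := by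
  obtain ⟨t, ht, hty⟩ := exists_lineMap_symm_im_eq Ψ (p := q) (q := p) hq hp
  refine ⟨1 - t, ⟨by linarith [ht.2], by linarith [ht.1]⟩, ?_⟩
  rwa [AffineMap.lineMap_apply_one_sub]

/-- Points of the segment `[p, q]` are within `dist p q` of both ends. [folklore] -/
theorem dist_lineMap_le_of_mem_Icc (p q : ℂ) {t : ℝ} (ht : t ∈ Icc (0 : ℝ) 1) :
    dist (AffineMap.lineMap p q t) p ≤ dist p q ∧ dist (AffineMap.lineMap p q t) q ≤ dist p q := by
  constructor
  · rw [dist_lineMap_left, Real.norm_eq_abs, abs_of_nonneg ht.1]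
    exact mul_le_of_le_one_left dist_nonneg ht.2
  · rw [dist_lineMap_right, Real.norm_eq_abs, abs_of_nonneg (by linarith [ht.2])]
    exact mul_le_of_le_one_left dist_nonneg (by linarith [ht.1])

/-! ## The transfer -/

/-- DETERMINISTIC CROSSING TRANSFER THROUGH A CHART. Let `Ψ` be a homeomorphism of the plane and let
`T = [a₀, a₁] × [b₀, b₁]` be taller and narrower than `W = [x₀, x₁] × [y₀, y₁]`, both inside `[-2, 2]²`.
There is `ε > 0` such that for every `0 < η ≤ ε`, every nonempty chain of points (`f`-images of a list)
with consecutive distances `≤ η`, all within `ε` of `Ψ(T)`, whose first point is within `ε` of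
`Ψ([a₀, a₁] × {b₀})` and whose last point is within `ε` of `Ψ([a₀, a₁] × {b₁})`, splits as
`m₁ ++ m₂ ++ m₃` with `m₂` nonempty, all points of `m₂` in `Ψ((x₀, x₁) × (y₀, y₁))`, the first point
of `m₂` within `η` of `Ψ([x₀, x₁] × {y₀})` and its last point within `η` of `Ψ([x₀, x₁] × {y₁})`.
(Schramm–Smirnov's comparison `Q^{q'} ≤ Q^q` of perturbed quads, in the metric form needed for shadows of
lattice paths.) [folklore] -/
theorem exists_transfer_eps {α : Type*} (Ψ : ℂ ≃ₜ ℂ) {x₀ a₀ a₁ x₁ b₀ y₀ y₁ b₁ : ℝ}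
    (h₁ : x₀ < a₀) (h₃ : a₁ < x₁) (h₄ : b₀ < y₀) (h₅ : y₀ < y₁) (h₆ : y₁ < b₁)
    (hx₀ : -2 ≤ x₀) (hx₁ : x₁ ≤ 2) (hb₀ : -2 ≤ b₀) (hb₁ : b₁ ≤ 2) :
    ∃ ε : ℝ, 0 < ε ∧ ∀ (f : α → ℂ) (l : List α) (η : ℝ), 0 < η → η ≤ ε →
      List.IsChain (fun a b => dist (f a) (f b) ≤ η) l →
      (∀ a ∈ l, ∃ z : ℂ, z.re ∈ Icc a₀ a₁ ∧ z.im ∈ Icc b₀ b₁ ∧ dist (f a) (Ψ z) ≤ ε) →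
      (∀ a, l.head? = some a → ∃ z : ℂ, z.re ∈ Icc a₀ a₁ ∧ z.im = b₀ ∧ dist (f a) (Ψ z) ≤ ε) →
      (∀ a, l.getLast? = some a → ∃ z : ℂ, z.re ∈ Icc a₀ a₁ ∧ z.im = b₁ ∧ dist (f a) (Ψ z) ≤ ε) →
      l ≠ [] →
      ∃ (m₁ m₂ m₃ : List α), l = m₁ ++ m₂ ++ m₃ ∧ m₂ ≠ [] ∧
        (∀ a ∈ m₂, ∃ z : ℂ, z.re ∈ Ioo x₀ x₁ ∧ z.im ∈ Ioo y₀ y₁ ∧ f a = Ψ z) ∧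
        (∀ a, m₂.head? = some a → ∃ z : ℂ, z.re ∈ Icc x₀ x₁ ∧ z.im = y₀ ∧ dist (f a) (Ψ z) ≤ η) ∧
        (∀ a, m₂.getLast? = some a → ∃ z : ℂ, z.re ∈ Icc x₀ x₁ ∧ z.im = y₁ ∧ dist (f a) (Ψ z) ≤ η) := by
  -- the margin `μ` and the chart room `ρ`
  set μ : ℝ := min (min (a₀ - x₀) (x₁ - a₁)) (min (min (y₀ - b₀) (b₁ - y₁)) (y₁ - y₀)) with hμdef
  have hμ0 : 0 < μ := lt_min (lt_min (by linarith) (by linarith))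
    (lt_min (lt_min (by linarith) (by linarith)) (by linarith))
  have hμ₁ : μ ≤ a₀ - x₀ := (min_le_left _ _).trans (min_le_left _ _)
  have hμ₂ : μ ≤ x₁ - a₁ := (min_le_left _ _).trans (min_le_right _ _)
  have hμ₃ : μ ≤ y₀ - b₀ := (min_le_right _ _).trans ((min_le_left _ _).trans (min_le_left _ _))
  have hμ₄ : μ ≤ b₁ - y₁ := (min_le_right _ _).trans ((min_le_left _ _).trans (min_le_right _ _))
  have hμ₅ : μ ≤ y₁ - y₀ := (min_le_right _ _).trans (min_le_right _ _)
  obtain ⟨ρ, hρ0, -, hroom⟩ := exists_chart_room Ψ (ν := μ / 4) (by positivity)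
  refine ⟨ρ / 2, by positivity, ?_⟩
  intro f l η hη0 hηε hchain hpts hhead hlast hl
  have hT : ∀ z : ℂ, z.re ∈ Icc a₀ a₁ → z.im ∈ Icc b₀ b₁ → z ∈ (Icc (-2 : ℝ) 2 ×ℂ Icc (-2 : ℝ) 2) :=
    fun z hre him => Complex.mem_reProdIm.2
      ⟨⟨by linarith [hre.1], by linarith [hre.2]⟩, ⟨by linarith [him.1], by linarith [him.2]⟩⟩
  -- model coordinates of the chain and of nearby points
  set g : α → ℂ := fun a => Ψ.symm (f a) with hgdef
  have key : ∀ a ∈ l, ∃ z : ℂ, z.re ∈ Icc a₀ a₁ ∧ z.im ∈ Icc b₀ b₁ ∧ dist (g a) z ≤ μ / 4 ∧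
      ∀ p : ℂ, dist p (f a) ≤ η → dist (Ψ.symm p) z ≤ μ / 4 := by
    intro a ha
    obtain ⟨z, hre, him, hd⟩ := hpts a ha
    refine ⟨z, hre, him, hroom z (hT z hre him) (f a) (hd.trans (by linarith)), fun p hp => ?_⟩
    exact hroom z (hT z hre him) p ((dist_triangle p (f a) (Ψ z)).trans (by linarith))
  have hgre : ∀ a ∈ l, a₀ - μ / 4 ≤ (g a).re ∧ (g a).re ≤ a₁ + μ / 4 := by
    intro a ha
    obtain ⟨z, hre, -, hd, -⟩ := key a ha
    have := abs_re_sub_le_dist (g a) z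
    rw [abs_le] at this
    constructor <;> linarith [hre.1, hre.2]
  have hnear : ∀ a ∈ l, ∀ p : ℂ, dist p (f a) ≤ η →
      |(Ψ.symm p).re - (g a).re| ≤ μ / 2 ∧ |(Ψ.symm p).im - (g a).im| ≤ μ / 2 := by
    intro a ha p hp
    obtain ⟨z, -, -, hd, hp'⟩ := key a ha
    have hdist : dist (Ψ.symm p) (g a) ≤ μ / 2 := by
      have := dist_triangle (Ψ.symm p) z (g a)
      rw [dist_comm z] at this
      linarith [hp' p hp]
    exact ⟨(abs_re_sub_le_dist _ _).trans hdist, (abs_im_sub_le_dist _ _).trans hdist⟩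
  -- consecutive points of the chain are `μ/2`-close in the model
  have hstep : ∀ {m₁ m₂ : List α} {a b : α}, l = m₁ ++ a :: b :: m₂ →
      |(g b).im - (g a).im| ≤ μ / 2 := by
    intro m₁ m₂ a b hlab
    have hab : dist (f a) (f b) ≤ η :=
      rel_of_isChain_append_cons_cons (R := fun a b => dist (f a) (f b) ≤ η) hchain hlab
    have ha : a ∈ l := by rw [hlab]; simp
    exact (hnear a ha (f b) (by rwa [dist_comm])).2
  -- the ends of the chain
  obtain ⟨hd, tl, rfl⟩ := List.exists_cons_of_ne_nil hl
  have hhd : (g hd).im < y₀ := by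
    obtain ⟨z, hre, him, hdz⟩ := hhead hd rfl
    have h1 : dist (g hd) z ≤ μ / 4 :=
      hroom z (hT z hre (by rw [him]; exact ⟨le_rfl, by linarith⟩)) (f hd) (hdz.trans (by linarith))
    have := abs_im_sub_le_dist (g hd) z
    rw [abs_le, him] at this
    linarith [this.2]
  have hlst : y₁ < (g ((hd :: tl).getLast (List.cons_ne_nil _ _))).im := by
    obtain ⟨z, hre, him, hdz⟩ := hlast _ (List.getLast?_eq_some_getLast _)
    have h1 : dist (g ((hd :: tl).getLast (List.cons_ne_nil _ _))) z ≤ μ / 4 :=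
      hroom z (hT z hre (by rw [him]; exact ⟨by linarith, le_rfl⟩)) _ (hdz.trans (by linarith))
    have := abs_im_sub_le_dist (g ((hd :: tl).getLast (List.cons_ne_nil _ _))) z
    rw [abs_le, him] at this
    linarith [this.1]
  -- first passage at height `≥ y₁`
  obtain ⟨m, b, r, hlm, hm, hb⟩ := exists_split_first (fun a => y₁ ≤ (g a).im) (hd :: tl)
    ⟨_, List.getLast_mem _, hlst.le⟩
  have hm0 : m ≠ [] := by
    rintro rfl
    have : hd = b := (List.cons_eq_cons.1 (by simpa using hlm)).1
    rw [this] at hhd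
    linarith
  -- last passage at height `≤ y₀` before it
  have hhdm : hd ∈ m := by
    obtain ⟨c, m', rfl⟩ := List.exists_cons_of_ne_nil hm0
    have : hd = c := (List.cons_eq_cons.1 (by simpa using hlm)).1
    rw [this]; exact List.mem_cons_self
  obtain ⟨m₁, a, m₂, hmm, ha, hm₂⟩ := exists_split_last (fun a => (g a).im ≤ y₀) m ⟨hd, hhdm, hhd.le⟩
  have hlfull : hd :: tl = m₁ ++ a :: (m₂ ++ b :: r) := by rw [hlm, hmm]; simp
  -- the middle piece is nonempty: otherwise `a` (low) and `b` (high) would be consecutive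
  have hm₂0 : m₂ ≠ [] := by
    rintro rfl
    have h := hstep (m₁ := m₁) (m₂ := r) (a := a) (b := b) (by rw [hlfull]; simp)
    rw [abs_le] at h
    have hb' : y₁ ≤ (g b).im := hb
    have ha' : (g a).im ≤ y₀ := ha
    linarith [h.2]
  obtain ⟨c, m₂', rfl⟩ := List.exists_cons_of_ne_nil hm₂0
  have hmem_l : ∀ e ∈ c :: m₂', e ∈ hd :: tl := fun e he => by
    rw [hlfull]; simp only [List.mem_append, List.mem_cons, List.cons_append] at he ⊢; tauto
  have hmem_m : ∀ e ∈ c :: m₂', e ∈ m := fun e he => by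
    rw [hmm]; simp only [List.mem_append, List.mem_cons] at he ⊢; tauto
  refine ⟨m₁ ++ [a], c :: m₂', b :: r, by rw [hlfull]; simp, List.cons_ne_nil _ _, ?_, ?_, ?_⟩
  · -- the middle piece lies in `Ψ(W°)`
    intro e he
    have h1 : (g e).im < y₁ := not_le.1 (hm e (hmem_m e he))
    have h2 : y₀ < (g e).im := not_le.1 (hm₂ e he)
    have h3 := hgre e (hmem_l e he)
    refine ⟨g e, ⟨by linarith [h3.1], by linarith [h3.2]⟩, ⟨h2, h1⟩, ?_⟩
    simp [hgdef]
  · -- its first point `c` is within `η` of `Ψ(bottom of W)`: the segment from `a` crosses `y₀`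
    intro e he
    have hec : e = c := by simpa using he.symm
    subst hec
    have hac : dist (f a) (f e) ≤ η :=
      rel_of_isChain_append_cons_cons (R := fun a b => dist (f a) (f b) ≤ η) hchain
        (m₁ := m₁) (m₂ := m₂' ++ b :: r) (by rw [hlfull]; simp)
    have hal : a ∈ hd :: tl := by rw [hlfull]; simp
    have hlow : (g a).im ≤ y₀ := ha
    have hhigh : y₀ ≤ (g e).im := (not_le.1 (hm₂ e List.mem_cons_self)).le
    obtain ⟨t, ht, hty⟩ := exists_lineMap_symm_im_eq Ψ (p := f a) (q := f e) hlow hhigh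
    have hseg := dist_lineMap_le_of_mem_Icc (f a) (f e) ht
    have hn := hnear a hal (AffineMap.lineMap (f a) (f e) t) (hseg.1.trans hac)
    have hga := hgre a hal
    refine ⟨Ψ.symm (AffineMap.lineMap (f a) (f e) t), ?_, hty, ?_⟩
    · rw [abs_le] at hn
      constructor <;> linarith [hn.1.1, hn.1.2, hga.1, hga.2]
    · rw [Homeomorph.apply_symm_apply, dist_comm]
      exact hseg.2.trans hac
  · -- its last point is within `η` of `Ψ(top of W)`: the segment to `b` crosses `y₁`
    intro e he
    have hemem : e ∈ c :: m₂' := List.mem_of_getLast? he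
    have hdb : dist (f e) (f b) ≤ η := by
      have hsplit : hd :: tl = (m₁ ++ a :: c :: m₂') ++ (b :: r) := by rw [hlfull]; simp
      have h3 := (List.isChain_append.1 (hsplit ▸ hchain)).2.2
      exact h3 e (by simp [List.getLast?_append, Option.mem_def, he]) b (by simp)
    have hel : e ∈ hd :: tl := hmem_l e hemem
    have hlow : (g e).im ≤ y₁ := (not_le.1 (hm e (hmem_m e hemem))).le
    obtain ⟨t, ht, hty⟩ := exists_lineMap_symm_im_eq Ψ (p := f e) (q := f b) hlow hb
    have hseg := dist_lineMap_le_of_mem_Icc (f e) (f b) ht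
    have hn := hnear e hel (AffineMap.lineMap (f e) (f b) t) (hseg.1.trans hdb)
    have hge := hgre e hel
    refine ⟨Ψ.symm (AffineMap.lineMap (f e) (f b) t), ?_, hty, ?_⟩
    · rw [abs_le] at hn
      constructor <;> linarith [hn.1.1, hn.1.2, hge.1, hge.2]
    · rw [Homeomorph.apply_symm_apply, dist_comm]
      exact hseg.1.trans hdb

end CouplingToLimits

/-- REGISTERED SUB-GOAL `stub_CouplingToLimits_transfer` of stub `stub_CouplingToLimits` (the deterministic
crossing transfer through a chart, `CouplingToLimits.exists_transfer_eps` at universe `0`). [folklore] -/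
theorem stub_CouplingToLimits_transfer :
    ∀ {α : Type} (Ψ : ℂ ≃ₜ ℂ) {x₀ a₀ a₁ x₁ b₀ y₀ y₁ b₁ : ℝ},
      x₀ < a₀ → a₁ < x₁ → b₀ < y₀ → y₀ < y₁ → y₁ < b₁ → -2 ≤ x₀ → x₁ ≤ 2 → -2 ≤ b₀ → b₁ ≤ 2 →
      ∃ ε : ℝ, 0 < ε ∧ ∀ (f : α → ℂ) (l : List α) (η : ℝ), 0 < η → η ≤ ε →
        List.IsChain (fun a b => dist (f a) (f b) ≤ η) l →
        (∀ a ∈ l, ∃ z : ℂ, z.re ∈ Set.Icc a₀ a₁ ∧ z.im ∈ Set.Icc b₀ b₁ ∧ dist (f a) (Ψ z) ≤ ε) →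
        (∀ a, l.head? = some a → ∃ z : ℂ, z.re ∈ Set.Icc a₀ a₁ ∧ z.im = b₀ ∧ dist (f a) (Ψ z) ≤ ε) →
        (∀ a, l.getLast? = some a → ∃ z : ℂ, z.re ∈ Set.Icc a₀ a₁ ∧ z.im = b₁ ∧ dist (f a) (Ψ z) ≤ ε) →
        l ≠ [] →
        ∃ (m₁ m₂ m₃ : List α), l = m₁ ++ m₂ ++ m₃ ∧ m₂ ≠ [] ∧
          (∀ a ∈ m₂, ∃ z : ℂ, z.re ∈ Set.Ioo x₀ x₁ ∧ z.im ∈ Set.Ioo y₀ y₁ ∧ f a = Ψ z) ∧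
          (∀ a, m₂.head? = some a → ∃ z : ℂ, z.re ∈ Set.Icc x₀ x₁ ∧ z.im = y₀ ∧ dist (f a) (Ψ z) ≤ η) ∧
          (∀ a, m₂.getLast? = some a → ∃ z : ℂ, z.re ∈ Set.Icc x₀ x₁ ∧ z.im = y₁ ∧ dist (f a) (Ψ z) ≤ η) :=
  fun Ψ _ _ _ _ _ _ _ _ h₁ h₃ h₄ h₅ h₆ hx₀ hx₁ hb₀ hb₁ =>
    CouplingToLimits.exists_transfer_eps Ψ h₁ h₃ h₄ h₅ h₆ hx₀ hx₁ hb₀ hb₁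

end Summit.CriticalPhenomena.CardyFormulaZ2.Theorems.IKLinearTransport.PinnedDiagramExchange

end
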